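import Summits.QuantumFields.BalabanUV.T4Continuum.Support.TorusBlockRefinementClosure
import Summits.QuantumFields.BalabanUV.T4Continuum.Spine.NE1p.DressedSmallFieldNestedTori

/-!
# T⁴ programme, spine estimate NE1′ (node O3b/H2) — THE TWO NESTINGS' SANDWICH: `Z ⊆ tclosure (trefine Z) ⊆ tcollar Z` — pv22's closure
# `Z₀ ↦ Z′₀` (S44's nesting) of S43's refined footprint sits INSIDE the coarse collar `Z̃`, because the block map is 1-LIPSCHITZ for the
# 3^d-blocks (S44 §1 BY NAME): `tcollar (trefine Z) ⊆ trefine (tcollar Z)`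

Cell `pub-balaban`, sub-cell `t4`, row NE1′ formalisation crew (`t4/formal/NE1p/LEAVES.md`; INTENT `HOME/CLAIMS.log` 2026-08-20), unit
`b2b-balaban-t4-ne1p-formalise-leaf-05` (LEAF PROVER 05, gen 12); sequel of the lineage's S54 `Support/TorusBlockRefinementClosure` (p239025
✓✓).  ADDITIVE — imports S54 (→ S47, S43.1, pv22 `TreeLengthTorusTransfer`) and crew row S44 `Spine/NE1p/DressedSmallFieldNestedTori`
(leaf-01 g13, p236153 ✓✓ — for its §1 `coarse_mem_block_of_mem_block` ∕ `proj_mem_tblock`, the 1-Lipschitz block map, BY NAME) ONLY;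
THEOREMS ONLY (0 `def`, 0 `def … : Prop`, 0 cite); nothing of S54 ∕ S44 ∕ S43 ∕ pv22 restated.

WHY THIS FILE.  S54 §2 left the reverse inclusion of the adjunction one-sided: `subset_tclosure_trefine : Z ⊆ tclosure L N′ (trefine L N′ Z)`
«in general LARGER — the collar of the footprint meets the neighbouring blocks».  HOW MUCH larger is decided here, in kernel, for every
`d`, `L`, `N′`: at most the coarse COLLAR.  §1 `block_symm` (□̃-membership is symmetric) and **`tcoarse_mem_tblock_of_mem_tblock`** — the
block map of the fine torus sends □̃(b) into □̃(tcoarse b) (S44 §1's `coarse_mem_block_of_mem_block` + `proj_mem_tblock` BY NAME, pv22's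
`tcoarse_proj`); §2 **`tcollar_trefine_subset`** (`tcollar (trefine L N′ Z) ⊆ trefine L N′ (tcollar Z)` — the fine collar of a refined
footprint lies in the refinement of the coarse collar), **`tclosure_trefine_subset_tcollar`** (`tclosure L N′ (trefine L N′ Z) ⊆ tcollar Z`,
by S54's `image_tcoarse_subset_iff`), the SANDWICH `Z ⊆ tclosure (trefine Z) ⊆ tcollar Z` (`subset_tclosure_trefine_subset_tcollar`) and its
Dom form for torus localization domains; §3 the block count it yields: `#(tclosure (trefine Z)) ≤ 3^d·#Z` (pv22's `card_tcollar_le`).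
Consumers (by name, nothing owed): closure-indexed rows (S44∕S51∕W59∕W67∕W75's `tclosureDom`) meeting footprint-indexed rows (S43.2∕S48∕
S53∕W71∕W79's `trefineDom`); the owner's N1a ∕ the substrate's (A) `within_fineEmb_domEmb_iff`.
HONEST FRAMING.  Finite-set ∕ lattice arithmetic on pv22's periodic index model; no END of the owner's fired; print's Z′ ∕ Z̃ ∕ □̃ ∕ L are
TYPE∕CONTEXT through pv22's cite-tagged modules ([Balaban1988RGII] p. 13 ∕ p. 19), asserted nowhere; WHICH pair of nested tori is
Bałaban's `(𝐃_{k+1}, 𝐃_k)` stays pv22's READING (D-pv22.3); [folklore] tags only.  Nothing of NE1′'s wall moves (wall WORDING v1.8,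
T4-DAG v48 — words, not kind); NE1′ ⇐ the named binders — NOT printed, NOT proved; spine PROVED 0∕9; count 9 unchanged.  Rung (B)+1 on ONE
finite four-torus — NOT infinite volume, NOT a mass gap, NOT OS on ℝ⁴, NOT Clay.  HONEST DEPENDENCY: continuum YM on T⁴ ⇐ BetaPertH ∧ nine
spine estimates (0/9 proved); BetaPertH ⇐ (D1) ∧ (D4) ∧ CAP+tail; G-an2-4 gates asym, D1 and NE2/3/4.
-/

namespace Summit.QuantumFields.BalabanUV.T4Continuum.NE1p.DressedSmallFieldNestedToriCollar

open Literature.MathematicalPhysics.QuantumFieldTheory.Balaban1983to89.B13ScaleTransfer (Pt block mem_block coarse)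
open Literature.MathematicalPhysics.QuantumFieldTheory.Balaban1983to89.TreeLengthTorus (TPt TDom proj natLift proj_natLift)
open Literature.MathematicalPhysics.QuantumFieldTheory.Balaban1983to89.TreeLengthTorusTransfer (tcoarse tcoarse_proj tblock tcollar tclosure
  tclosureDom tblock_subset_tcollar card_tcollar_le)
open Summit.QuantumFields.BalabanUV.T4Continuum.TorusBlockRefinement (trefine trefineDom mem_trefine)
open Summit.QuantumFields.BalabanUV.T4Continuum.TorusBlockRefinementClosure (image_tcoarse_subset_iff subset_tclosure_trefine)
open Summit.QuantumFields.BalabanUV.T4Continuum.NE1p.DressedSmallFieldNestedTori (coarse_mem_block_of_mem_block proj_mem_tblock)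

variable {d : ℕ} {L N' : ℕ} [NeZero L] [NeZero N']

/-! ## §1 The block map is 1-Lipschitz for the 3^d-blocks of the fine torus -/

/-- □̃-membership on the universal cover is symmetric (`|yᵢ − xᵢ| ≤ 1`). [folklore] -/
theorem block_symm {x y : Pt d} (h : y ∈ block x) : x ∈ block y := by
  rw [mem_block] at h ⊢
  intro i
  obtain ⟨h1, h2⟩ := h i
  exact ⟨by linarith, by linarith⟩

/-- **THE BLOCK MAP SENDS □̃(b) INTO □̃(tcoarse b)** [folklore]: if the fine cube `a` lies in the 3^d-block of `b`, then its block
`tcoarse a` lies in the 3^d-block of `tcoarse b` on the coarse torus (S44 §1's 1-Lipschitz lemma + `proj_mem_tblock` BY NAME, pv22's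
`tcoarse_proj`). -/
theorem tcoarse_mem_tblock_of_mem_tblock {a b : TPt d (L * N')} (h : a ∈ tblock b) : tcoarse L N' a ∈ tblock (tcoarse L N' b) := by
  have hL : 0 < L := Nat.pos_of_ne_zero (NeZero.ne L)
  unfold tblock at h
  obtain ⟨y, hy, rfl⟩ := Finset.mem_image.1 h
  rw [tcoarse_proj]
  have hc : coarse L y ∈ block (coarse L (natLift b)) := block_symm (coarse_mem_block_of_mem_block hL hy)
  have h' := proj_mem_tblock (N := N') hc
  rwa [← tcoarse_proj, proj_natLift] at h'

/-! ## §2 The sandwich `Z ⊆ tclosure (trefine Z) ⊆ tcollar Z` -/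

/-- **THE FINE COLLAR OF A REFINED FOOTPRINT LIES IN THE REFINEMENT OF THE COARSE COLLAR** [folklore]:
`tcollar (trefine L N′ Z) ⊆ trefine L N′ (tcollar Z)`. -/
theorem tcollar_trefine_subset (Z : Finset (TPt d N')) : tcollar (trefine L N' Z) ⊆ trefine L N' (tcollar Z) := by
  intro a ha
  unfold tcollar at ha
  obtain ⟨b, hb, hab⟩ := Finset.mem_biUnion.1 ha
  exact mem_trefine.2 (tblock_subset_tcollar (mem_trefine.1 hb) (tcoarse_mem_tblock_of_mem_tblock hab))

/-- **pv22's CLOSURE OF S43's REFINED FOOTPRINT SITS INSIDE THE COARSE COLLAR** [folklore]: `tclosure L N′ (trefine L N′ Z) ⊆ tcollar Z`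
(S54's adjunction `image_tcoarse_subset_iff` + §2's first lemma). -/
theorem tclosure_trefine_subset_tcollar (Z : Finset (TPt d N')) : tclosure L N' (trefine L N' Z) ⊆ tcollar Z :=
  image_tcoarse_subset_iff.2 (tcollar_trefine_subset Z)

/-- **THE SANDWICH** [folklore]: `Z ⊆ tclosure L N′ (trefine L N′ Z) ⊆ tcollar Z` — the closure of a refined footprint contains the
polymer (S54) and is contained in its coarse collar (here). -/
theorem subset_tclosure_trefine_subset_tcollar (Z : Finset (TPt d N')) :
    Z ⊆ tclosure L N' (trefine L N' Z) ∧ tclosure L N' (trefine L N' Z) ⊆ tcollar Z :=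
  ⟨subset_tclosure_trefine Z, tclosure_trefine_subset_tcollar Z⟩

/-- Dom form [folklore]: for a torus localization domain `Z` of the coarse torus, pv22's `tclosureDom` of S43.1's `trefineDom Z` has its
cubes inside the collar of `Z`. -/
theorem tclosureDom_trefineDom_subset_tcollar (Z : TDom d N') : (tclosureDom L N' (trefineDom L N' Z)).1 ⊆ tcollar Z.1 :=
  tclosure_trefine_subset_tcollar Z.1

/-- If the fine collar of `S` avoids the refinement of the blocks outside `Z` — i.e. `tcollar S ⊆ trefine Z` — then the closure of `S`
stays inside `Z` (S54's `tclosure_subset_iff`, restated as the one-directional tool the junction rows use). [folklore] -/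
theorem tclosure_subset_of_tcollar_subset_trefine {S : Finset (TPt d (L * N'))} {Z : Finset (TPt d N')} (h : tcollar S ⊆ trefine L N' Z) :
    tclosure L N' S ⊆ Z :=
  image_tcoarse_subset_iff.2 h

/-! ## §3 The block count of the closure of a refined footprint -/

/-- **AT MOST `3^d` BLOCKS PER CUBE OF `Z`** [folklore]: `#(tclosure L N′ (trefine L N′ Z)) ≤ 3^d·#Z` (the sandwich + pv22's
`card_tcollar_le`). -/
theorem card_tclosure_trefine_le (Z : Finset (TPt d N')) : (tclosure L N' (trefine L N' Z)).card ≤ 3 ^ d * Z.card :=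
  (Finset.card_le_card (tclosure_trefine_subset_tcollar Z)).trans (card_tcollar_le Z)

/-- Decided instance on the four-torus [decided toy]: the closure of the `L = 3` refinement of a family `Z` has at most `81·#Z` blocks. -/
example (Z : Finset (TPt 4 N')) : (tclosure 3 N' (trefine 3 N' Z)).card ≤ 81 * Z.card := by
  have h := card_tclosure_trefine_le (L := 3) Z; norm_num at h; exact h

end Summit.QuantumFields.BalabanUV.T4Continuum.NE1p.DressedSmallFieldNestedToriCollar
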